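import Mathlib
import HarnessLib
import Summits.NavierStokesRegularity.NavierStokesRegularity.Theorems.UnthreadedRigidityDoorUnthreadedRigidityVirialHornBracketSum
import Summits.NavierStokesRegularity.NavierStokesRegularity.Theorems.ThreadingFluxHorizonTowerZonalAssembly
import Summits.NavierStokesRegularity.NavierStokesRegularity.Theorems.UnthreadedRigidityDoorUnthreadedRigidityVirialHornBridgeWOfInjective
import Summits.NavierStokesRegularity.NavierStokesRegularity.Theorems.UnthreadedRigidityDoorUnthreadedRigidityThreadingJetsWindowDegreeOne
import Summits.NavierStokesRegularity.NavierStokesRegularity.Theorems.UnthreadedRigidityDoorUnthreadedRigidityVirialHornBracketTwo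

/-!
# VIRIAL HORN, W-ii (6/6): ★★★ BRACKET INJECTIVITY IN EVERY DEGREE `bracketInjective_all`, BRIDGE W `windowWedgeAnalyticL_holds`, THE WINDOW RUNG `isotypicWindowRigidity_all`

Route `UnthreadedRigidityDoor`, item `UnthreadedRigidity` (W2, stmt-NavierStokesRegularity-27585) — LINE g11-1 «VIRIAL HORN»,
DIRECTOR-NS KEY-NS #210 (W-ii): the ALL-DEGREE BRACKET INJECTIVITY `bracketInjective_all` (= the hypothesis `hinj` of p712484
`windowWedgeAnalyticL_of_bracketInjective`, every `l ≥ 1`), by a kernel road that needs neither the `SO(3)`-isotypic decomposition of `Λ²𝓗_l`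
nor a closed form of Legendre coefficients (ns-crc-p2 g10; `--supports stmt-NavierStokesRegularity-27585`, helper; 0 kit).

CONTENT.  ★★★ `Coherent.tripleC_injective` (complex form): for `l ≥ 1` and any linearly independent family `P` of `Δ̃`-harmonic homogeneous
polynomials of degree `l` in `ℂ[W,V,Z]`, `Σ_{m,m′} w_{mm′} tripleC(P_m, P_{m′}) = 0 ⇒ w` symmetric (coordinates `C` in the coherent frame — file 5;
the congruent array `a = Cᵀ w C` has `brSum l (a − aᵀ) = 0`, so all certificates of its raising string vanish — file 5 — so `a = aᵀ` — file 4; rows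
of `C` are independent, so `w = wᵀ`).  ★★★ `VirialHorn.bracketInjective_all` — the hypothesis `hinj` of p712484 VERBATIM for every `l ≥ 1`:
for every linearly independent family `B` of solid harmonics of degree `l` on `ℝ³` and every real array `w`,
`(∀ y, Σ_{m,m′} w_{mm′} {B_m, B_{m′}}(y) = 0) → w` symmetric — i.e. `Y ∧ Z ↦ {Y,Z} = det[y,∇Y,∇Z]` is INJECTIVE on `Λ²𝓗_l` (transfer: g9's
`IsSolidHarmonic.exists_evalE` / `pbr_evalE`, W1's `Zonal.eq_zero_of_evalE_eq_zero`, complexification `theta` with `tripleC_theta`,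
`lapC_theta`, `eq_of_theta_eq`).  BY NAME: ★★ `windowWedgeAnalyticL_holds : WindowWedgeAnalyticL` (BRIDGE W of the line, p712484 fed with
`bracketInjective_all`) and ★★ `ThreadingJets.isotypicWindowRigidity_all (l n) (hl : 1 ≤ l) : IsotypicWindowRigidityL l n` (ns-crc-p1's
per-degree window rung p715311 fed with `bracketInjective_all`): every unthreaded window — hypotheses of `UnthreadedRigidity` VERBATIM — all of
whose slices are admissible degree-`l` isotypic poloidal data about `x₀` over a fixed independent family of solid harmonics is axisymmetric about
one common axis through `x₀`, for EVERY `l ≥ 1` (degrees `1, 2, 3`: p715311, p722960).  Isotypic windows are SPECIAL data (general windows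
superpose degrees — the line's own «why it might fail»).

HONEST LABEL: the algebra (`tripleC_injective`, `bracketInjective_all`) is finite-dimensional polynomial algebra about solid harmonics in W1's
complex-coordinate currency (`Zonal.CPoly`, `tripleC = −i·det(∇·,∇·,x)`, `lapC`, `theta` — imported by name, nothing re-declared); the two
by-name closures `windowWedgeAnalyticL_holds` / `isotypicWindowRigidity_all` are statements about HYPOTHETICAL isotypic windows of bounded mild
solutions (SPECIAL data of one RUNG line) obtained by pure composition of landed files; nothing here asserts blow-up or regularity;
`UnthreadedRigidity` ⟨27585⟩, W2 and NS regularity remain OPEN — no summit statement is proved.  [folklore]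
-/

-- the summit and its single sub-problem share the name (CONVENTIONS §1)
set_option linter.dupNamespace false

noncomputable section

open MvPolynomial Finsupp

namespace Summit.NavierStokesRegularity.NavierStokesRegularity.Theorems.UnthreadedRigidity.VirialHorn.Coherent

open Summit.NavierStokesRegularity.NavierStokesRegularity.Theorems.PoloidalLiouville.HorizonTower.Zonal
  (CPoly wt lapC lam tripleC dotC tri)

section ComplexTheorem

open Summit.NavierStokesRegularity.NavierStokesRegularity.Theorems.PoloidalLiouville.HorizonTower.Zonal (tripleC_swap)

/-- rows of the coefficient matrix of an independent family are independent (no independence of the frame needed). -/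
theorem linearIndependent_coeffs {n N : ℕ} {P : Fin n → CPoly} (hP : LinearIndependent ℂ P) (Cf : Fin n → ℕ → ℂ)
    (F : ℕ → CPoly) (hCf : ∀ m, P m = ∑ k ∈ Finset.range N, Cf m k • F k) :
    LinearIndependent ℂ Cf := by
  rw [Fintype.linearIndependent_iff] at hP ⊢
  intro g hg
  apply hP g
  have hcoef : ∀ k, ∑ m, g m * Cf m k = 0 := fun k => by
    have := congrFun hg k
    simpa [Finset.sum_apply, Pi.smul_apply, smul_eq_mul] using this
  calc ∑ m, g m • P m = ∑ m, ∑ k ∈ Finset.range N, (g m * Cf m k) • F k := by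
        refine Finset.sum_congr rfl fun m _ => ?_
        rw [hCf m, Finset.smul_sum]
        simp only [smul_smul]
    _ = ∑ k ∈ Finset.range N, (∑ m, g m * Cf m k) • F k := by
        rw [Finset.sum_comm]
        simp only [Finset.sum_smul]
    _ = 0 := by simp [hcoef]

/-- exchanging a double outer summation with a double inner summation. -/
theorem sum_comm_four' {α β M : Type*} [AddCommMonoid M] (s : Finset α) (t : Finset β) (g : α → α → β → β → M) :
    ∑ j ∈ s, ∑ k ∈ s, ∑ m ∈ t, ∑ m' ∈ t, g j k m m' = ∑ m ∈ t, ∑ m' ∈ t, ∑ j ∈ s, ∑ k ∈ s, g j k m m' := by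
  calc ∑ j ∈ s, ∑ k ∈ s, ∑ m ∈ t, ∑ m' ∈ t, g j k m m' = ∑ j ∈ s, ∑ m ∈ t, ∑ k ∈ s, ∑ m' ∈ t, g j k m m' :=
        Finset.sum_congr rfl fun j _ => Finset.sum_comm
    _ = ∑ m ∈ t, ∑ j ∈ s, ∑ k ∈ s, ∑ m' ∈ t, g j k m m' := Finset.sum_comm
    _ = ∑ m ∈ t, ∑ j ∈ s, ∑ m' ∈ t, ∑ k ∈ s, g j k m m' :=
        Finset.sum_congr rfl fun m _ => Finset.sum_congr rfl fun j _ => Finset.sum_comm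
    _ = ∑ m ∈ t, ∑ m' ∈ t, ∑ j ∈ s, ∑ k ∈ s, g j k m m' := Finset.sum_congr rfl fun m _ => Finset.sum_comm

/-- ★★★ THE COMPLEX THEOREM: for every `l ≥ 1` and every linearly independent family `P` of `Δ̃`-harmonic homogeneous
polynomials of degree `l` in `ℂ[W,V,Z]`, the triple products `{P_m, P_{m′}}` are injective on coefficient arrays:
`Σ_{m,m′} w_{mm′} {P_m, P_{m′}} = 0 ⇒ w` symmetric. -/
theorem tripleC_injective {l n : ℕ} (hl : 1 ≤ l) (P : Fin n → CPoly) (hPh : ∀ m, (P m).IsHomogeneous l)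
    (hPl : ∀ m, lapC (P m) = 0) (hind : LinearIndependent ℂ P) (w : Fin n → Fin n → ℂ)
    (hw : ∑ m, ∑ m', w m m' • tripleC (P m) (P m') = 0) : ∀ m m', w m m' = w m' m := by
  classical
  -- coordinates in the coherent frame, cut off beyond `2l`
  choose Cf0 hCf0 using fun m => exists_eq_sum_smul_Phi (hPh m) (hPl m)
  let Cf : Fin n → ℕ → ℂ := fun m k => if k < 2 * l + 1 then Cf0 m k else 0
  have hCf : ∀ m, P m = ∑ k ∈ Finset.range (2 * l + 1), Cf m k • Phi l k := fun m => by
    rw [hCf0 m]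
    exact Finset.sum_congr rfl fun k hk => by simp only [Cf]; rw [if_pos (Finset.mem_range.mp hk)]
  have hCfN : ∀ m k, 2 * l + 1 ≤ k → Cf m k = 0 := fun m k hk => by simp only [Cf]; rw [if_neg (not_lt.mpr hk)]
  -- the congruent array `a = Cfᵀ w Cf` and its antisymmetrisation `b`
  let a : ℕ → ℕ → ℂ := fun j k => ∑ m, ∑ m', w m m' * (Cf m j * Cf m' k)
  have hbr_a : brSum l a = 0 := by
    rw [← hw]
    unfold brSum
    simp only [a, Finset.sum_smul]
    rw [sum_comm_four']
    refine Finset.sum_congr rfl fun m _ => Finset.sum_congr rfl fun m' _ => ?_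
    rw [hCf m, hCf m', tripleC_sum_smul_sum_smul, Finset.smul_sum]
    refine Finset.sum_congr rfl fun j _ => ?_
    rw [Finset.smul_sum]
    refine Finset.sum_congr rfl fun k _ => ?_
    rw [smul_smul]
  let b : ℕ → ℕ → ℂ := fun j k => a j k - a k j
  have hb_anti : ∀ j k, b k j = -b j k := fun j k => by simp only [b]; ring
  have ha_supp : ∀ j k, 2 * l < j ∨ 2 * l < k → a j k = 0 := by
    intro j k h
    rcases h with h | h
    · simp [a, hCfN _ j (by omega)]
    · simp [a, hCfN _ k (by omega)]
  have hb_supp : ∀ j k, 2 * l < j ∨ 2 * l < k → b j k = 0 := by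
    intro j k h
    simp only [b, ha_supp j k h, ha_supp k j h.symm, sub_zero]
  have hbr_b : brSum l b = 0 := by
    have hswap : ∑ j ∈ Finset.range (2 * l + 1), ∑ k ∈ Finset.range (2 * l + 1), a k j • tripleC (Phi l j) (Phi l k)
        = -brSum l a := by
      unfold brSum
      rw [Finset.sum_comm, ← Finset.sum_neg_distrib]
      refine Finset.sum_congr rfl fun j _ => ?_
      rw [← Finset.sum_neg_distrib]
      refine Finset.sum_congr rfl fun k _ => ?_
      rw [tripleC_swap, smul_neg]
    have h : brSum l b = brSum l a
        - ∑ j ∈ Finset.range (2 * l + 1), ∑ k ∈ Finset.range (2 * l + 1), a k j • tripleC (Phi l j) (Phi l k) := by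
      unfold brSum
      simp only [b, sub_smul, Finset.sum_sub_distrib]
    rw [h, hswap, hbr_a, neg_zero, sub_zero]
  -- the array theorem: `b = 0`, i.e. `a` is symmetric
  have hb0 : b = 0 :=
    eq_zero_of_cert_iterate_raiseArr hb_anti hb_supp (fun r M hM hMl => cert_iterate_raiseArr_eq_zero hl hbr_b r M hM hMl)
  have hsym : ∀ j k, a j k = a k j := fun j k => sub_eq_zero.mp (by have := congrFun (congrFun hb0 j) k; simpa [b] using this)
  -- `Cfᵀ (w − wᵀ) Cf = 0` with independent rows of `Cf` ⇒ `w = wᵀ`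
  have hrows := linearIndependent_coeffs hind Cf (Phi l) hCf
  rw [Fintype.linearIndependent_iff] at hrows
  have hanti : ∀ j k, ∑ m, ∑ m', (w m m' - w m' m) * (Cf m j * Cf m' k) = 0 := by
    intro j k
    have h1 := hsym j k
    simp only [a] at h1
    have h2 : ∑ m, ∑ m', w m m' * (Cf m k * Cf m' j) = ∑ m, ∑ m', w m' m * (Cf m j * Cf m' k) := by
      rw [Finset.sum_comm]
      exact Finset.sum_congr rfl fun m _ => Finset.sum_congr rfl fun m' _ => by ring
    rw [h2] at h1
    simp only [sub_mul, Finset.sum_sub_distrib]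
    rw [h1, sub_self]
  have hu : ∀ k m, ∑ m', (w m m' - w m' m) * Cf m' k = 0 := by
    intro k
    have key := hrows (fun m => ∑ m', (w m m' - w m' m) * Cf m' k) ?_
    · exact key
    · funext j
      simp only [Finset.sum_apply, Pi.smul_apply, smul_eq_mul, Pi.zero_apply]
      rw [← hanti j k]
      refine Finset.sum_congr rfl fun m _ => ?_
      rw [Finset.sum_mul]
      exact Finset.sum_congr rfl fun m' _ => by ring
  intro m m'
  have key := hrows (fun m' => w m m' - w m' m) ?_
  · exact sub_eq_zero.mp (key m')
  · funext k
    simp only [Finset.sum_apply, Pi.smul_apply, smul_eq_mul, Pi.zero_apply]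
    exact hu k m

end ComplexTheorem

end Summit.NavierStokesRegularity.NavierStokesRegularity.Theorems.UnthreadedRigidity.VirialHorn.Coherent

/-! ## The real theorem BY NAME: `hinj` of p712484 for every degree, bridge W, the window rung in every degree -/

namespace Summit.NavierStokesRegularity.NavierStokesRegularity.Theorems.UnthreadedRigidity.VirialHorn

open Summit.NavierStokesRegularity.NavierStokesRegularity.Theorems.UnthreadedRigidity.ProfileHorn (E3)
open Summit.NavierStokesRegularity.NavierStokesRegularity.Theorems.PoloidalLiouville.HorizonTower hiding E3

/-- complexification keeps real families independent. -/
theorem linearIndependent_map_complex {n : ℕ} {P : Fin n → MvPolynomial (Fin 3) ℝ} (hP : LinearIndependent ℝ P) :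
    LinearIndependent ℂ (fun m => MvPolynomial.map (algebraMap ℝ ℂ) (P m)) := by
  rw [Fintype.linearIndependent_iff] at hP ⊢
  intro c hc
  have hcoef : ∀ d, ∑ m, c m * ((coeff d (P m) : ℝ) : ℂ) = 0 := fun d => by
    have := congrArg (coeff d) hc
    simpa [coeff_sum, coeff_smul, coeff_map] using this
  have hre : ∑ m, (fun m => (c m).re) m • P m = 0 := by
    ext d
    have := congrArg Complex.re (hcoef d)
    simpa [coeff_sum, coeff_smul, Complex.re_sum] using this
  have him : ∑ m, (fun m => (c m).im) m • P m = 0 := by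
    ext d
    have := congrArg Complex.im (hcoef d)
    simpa [coeff_sum, coeff_smul, Complex.im_sum] using this
  intro m
  apply Complex.ext
  · simpa using hP _ hre m
  · simpa using hP _ him m

/-- ★★★ **BRACKET INJECTIVITY IN EVERY DEGREE** — the hypothesis `hinj` of `windowWedgeAnalyticL_of_bracketInjective` (p712484),
VERBATIM, for all `l ≥ 1`: for every linearly independent family `B` of solid harmonics of degree `l` on `ℝ³`, the brackets
`{B_m, B_{m′}} = det[y, ∇B_m, ∇B_{m′}]` are injective on coefficient arrays —
`(∀ y, Σ_{m,m′} w_{mm′} {B_m,B_{m′}}(y) = 0) → w` symmetric (equivalently: `Y ∧ Z ↦ {Y,Z}` is injective on `Λ²𝓗_l`). -/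
theorem bracketInjective_all : ∀ (l n : ℕ) (B : Fin n → E3 → ℝ), 1 ≤ l → (∀ m, IsSolidHarmonic l (B m)) → LinearIndependent ℝ B →
    ∀ w : Fin n → Fin n → ℝ, (∀ y : E3, ∑ m, ∑ m', w m m' * pbr (B m) (B m') y = 0) → ∀ m m', w m m' = w m' m := by
  intro l n B hl hB hBi w hw
  classical
  -- real polynomials behind the family
  choose P hPh hPl hBP using fun m => (hB m).exists_evalE
  -- the real polynomial identity `Σ w detP(P_m, P_m') = 0`
  have hdet : ∑ m, ∑ m', w m m' • Zonal.detP (P m) (P m') = 0 := by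
    refine Zonal.eq_zero_of_evalE_eq_zero fun y => ?_
    have h := hw y
    simp only [hBP, pbr_evalE] at h
    unfold Zonal.evalE at h ⊢
    simpa [map_sum, smul_eval] using h
  -- independence of the real polynomials
  have hPi : LinearIndependent ℝ P := by
    rw [Fintype.linearIndependent_iff] at hBi ⊢
    intro g hg
    refine hBi g ?_
    funext y
    have := congrArg (fun p => Zonal.evalE p y) hg
    unfold Zonal.evalE at this
    simpa [map_sum, smul_eval, hBP, Zonal.evalE, Finset.sum_apply] using this
  -- complexify and pass to `ℂ[W,V,Z]`
  set Q : Fin n → Zonal.CPoly := fun m => Zonal.theta (MvPolynomial.map (algebraMap ℝ ℂ) (P m)) with hQ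
  have hQh : ∀ m, (Q m).IsHomogeneous l := fun m => Zonal.isHomogeneous_theta ((hPh m).map _)
  have hQl : ∀ m, Zonal.lapC (Q m) = 0 := fun m => by
    rw [hQ]; simp only; rw [Zonal.lapC_theta, ← Zonal.map_lapP, hPl m, map_zero, map_zero]
  have hQi : LinearIndependent ℂ Q :=
    (linearIndependent_map_complex hPi).map' Zonal.theta.toLinearMap
      (LinearMap.ker_eq_bot.mpr fun a b h => Zonal.eq_of_theta_eq a b h)
  have hQw : ∑ m, ∑ m', (w m m' : ℂ) • Zonal.tripleC (Q m) (Q m') = 0 := by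
    have h1 : ∀ m m', (w m m' : ℂ) • Zonal.tripleC (Q m) (Q m')
        = -C Complex.I * Zonal.theta (MvPolynomial.map (algebraMap ℝ ℂ) (w m m' • Zonal.detP (P m) (P m'))) := by
      intro m m'
      rw [MvPolynomial.smul_eq_C_mul, MvPolynomial.smul_eq_C_mul, map_mul, map_C, map_mul, MvPolynomial.algHom_C,
        MvPolynomial.algebraMap_eq, hQ]
      simp only
      rw [Zonal.tripleC_theta, ← Zonal.map_detP]
      simp only [Complex.coe_algebraMap]
      ring
    simp only [h1, ← Finset.mul_sum, ← map_sum]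
    rw [hdet, map_zero, map_zero, mul_zero]
  have h := Coherent.tripleC_injective hl Q hQh hQl hQi (fun m m' => (w m m' : ℂ)) hQw
  intro m m'
  exact_mod_cast h m m'

/-- ★★ **BRIDGE W IS A THEOREM**: `WindowWedgeAnalyticL` — in every silent isotypic window of every degree `l ≥ 1` over a linearly
independent family of solid harmonics, all radial Wronskians of the coefficient profiles vanish and the profiles are analytic on `(0,∞)`
(p712484 `windowWedgeAnalyticL_of_bracketInjective` fed with `bracketInjective_all`).  A statement about HYPOTHETICAL isotypic windows
(special data); ⟨27585⟩, W2 and NS regularity remain OPEN. -/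
theorem windowWedgeAnalyticL_holds : WindowWedgeAnalyticL :=
  windowWedgeAnalyticL_of_bracketInjective bracketInjective_all

end Summit.NavierStokesRegularity.NavierStokesRegularity.Theorems.UnthreadedRigidity.VirialHorn

namespace Summit.NavierStokesRegularity.NavierStokesRegularity.Theorems.UnthreadedRigidity.ThreadingJets

open Summit.NavierStokesRegularity.NavierStokesRegularity.Theorems.UnthreadedRigidity.VirialHorn
  (IsotypicWindowRigidityL bracketInjective_all)

/-- ★★ **THE WINDOW RUNG IN EVERY DEGREE, UNCONDITIONALLY**: `IsotypicWindowRigidityL l n` for all `l ≥ 1` and all `n` — every unthreaded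
window (hypotheses of `UnthreadedRigidity` VERBATIM) all of whose slices are admissible degree-`l` isotypic poloidal data about `x₀` over a fixed
linearly independent family of solid harmonics is axisymmetric about one common axis through `x₀` (ns-crc-p1's per-degree rung p715311 fed with
`bracketInjective_all`).  SPECIAL data; ⟨27585⟩ / W2 / NS regularity OPEN. -/
theorem isotypicWindowRigidity_all (l n : ℕ) (hl : 1 ≤ l) : IsotypicWindowRigidityL l n :=
  isotypicWindowRigidityL_of_bracketInjective_at l (fun n B hB hBi w hw => bracketInjective_all l n B hl hB hBi w hw) n hl

end Summit.NavierStokesRegularity.NavierStokesRegularity.Theorems.UnthreadedRigidity.ThreadingJets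

end
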